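import Literature.AlgebraicGeometry.Morphisms.HomSchemeOfProjective            -- F22 FILE «II-b» (F0P1a-p03 (g0)): (II-b) `Morphisms.exists_homScheme_of_projective`
import Literature.AlgebraicGeometry.Morphisms.LawLocusOfHomScheme              -- ★ p795135 (B-p20 (g15), L9): (II-c₁) modulo (II-b) `Morphisms.lawLocus_of_homScheme`
import Literature.AlgebraicGeometry.AbelianSchemes.GroupLawLocusSmooth         -- ★ p793647 (B-typ03 (g19)): (II-c₂) `groupLawLocus_smooth_of_infinitesimalLifting`
import Literature.AlgebraicGeometry.AbelianSchemes.GroupLawLocusOpenImmersion  -- ★ p793304 (B-typ03 (g19)): (II-d) `isOpenImmersion_lawLocus_of_smooth`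
import Literature.AlgebraicGeometry.AbelianSchemes.GroupLawLocusAssembly       -- ★ p794138 (B-p20 (g15), P2): (II-e) `groupLawLocus_assembly`
import Literature.AlgebraicGeometry.AbelianSchemes.AbelianSchemeGroupLawLifts  -- ★ p795442 (B-p01 (g16), FILE A): (II-a-E) `AbelianSchemeOver.exists_mul_lift_of_isPullback_specMap_mk`
import Literature.AlgebraicGeometry.AbelianSchemes.AbelianSchemeOfLiftedGroupLaw -- ★ p793305 (B-p04 (g22)): (II-a-B) `AbelianSchemeOver.exists_grpObj_isBaseChangeVia_of_lift`
import HarnessLib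

/-!
# Linear rigidification, step (II): the open locus of abelian-scheme structures — [MumfordFogartyKirwan1994] Ch. 6 §3 Prop. 6.16 (p. 126)
# with Prop. 6.15 (p. 124) inside; the representability half of Thm. 6.14 for PROJECTIVE `p₁`

Topic `Literature/AlgebraicGeometry/AbelianSchemes`; namespace `Literature.AlgebraicGeometry.AbelianSchemes`.  THEOREMS ONLY (no definition, no
named fact, no instance, no notation, no `sorry`); universe `0` (the cell's `AbelianSchemeOver` ∕ Hilbert-scheme currency).  Cell `hodgecm-mathlib`
(D-0151 ∕ D-0183 FLOOR 0), programme HC_CM, P1 sub-line F-4 `Cruxes/HDel/Lines/F4LinearRigidificationII.lean` (crux item stmt-HodgeConjecture-24835):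
this file RE-HOMES that line's kernel-checked composition `stub_IIrep'_of` as a LIBRARY theorem (lead B-p17 (g15) ruling J-P1a-10, 2026-08-30T22:49Z:
`Cruxes/…/Lines` modules are not importable on the farm, so every consumer — the registry letter `stub_II := hII″` (edition-set memo d64ba528, Q7), the
P1 head `F0_SiegelModuli`, the `stub_Flarge` ∕ F-12 closer — cites THIS name).  HC_CM is proved only modulo the 7 printed citations until rung 0 closes;
this file discharges none of them.

## Statements
* `AbelianSchemeOver.exists_grpObj_extending_of_smallExtension` — **[MFK94] Prop. 6.15** (p. 124) as lettered in the line's (II-a) `stub_IIa`: `A` an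
  Artin local ring, `J ⊆ A` a proper ideal with `𝔪·J = 0`, `X → Spec A` proper and smooth with geometrically connected fibres and a section `ε`, `A₀` an
  abelian scheme over `Spec (A⧸J)` on `X ×_A (A⧸J)` (cartesian `G`) whose unit is the restriction of `ε`: then `X` carries a group law with unit `ε`
  making it an abelian scheme over `Spec A` of which `A₀` is the base change AS A GROUP SCHEME (★ `AbelianSchemeOver.IsBaseChangeVia`).  Six lines over
  the two halves: (II-a-E) the law LIFTS as a morphism (★ `AbelianSchemeOver.exists_mul_lift_of_isPullback_specMap_mk`, `AbelianSchemes/AbelianSchemeGroupLawLifts`,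
  B-p01 (g16)) and (II-a-B) ANY lift is an abelian-scheme law extending the given one (★ `AbelianSchemeOver.exists_grpObj_isBaseChangeVia_of_lift`,
  `AbelianSchemes/AbelianSchemeOfLiftedGroupLaw`, B-p04 (g22)).  No characteristic hypothesis.
* `AbelianSchemeOver.exists_groupLawLocus_of_projective` — **[MFK94] Prop. 6.16** (p. 126) in the F-4 letter's currency = the (β)+(γ) letter hII″
  (B-p17 (g15) `B-provers/B-p17/g15/hII-double-prime.letter.B-p17g15.txt` 3c9b90749a899d48) under `∀ (g : ℕ)`, ≡ the line's `stub_IIrep'` character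
  for character: for `p₁ : Z₁ → H₁` proper, smooth, with geometrically connected fibres AND PROJECTIVE (★ `Morphisms.IsProjective`), over a `ℚ`-scheme
  `H₁` locally of finite type, with a section `ε₁`, the sub-functor of `H₁` «`Z₁ ×_{H₁} T → T` carries a group law with unit `ε₁|_T`, smooth of relative
  dimension `g`» is represented by an OPEN immersion `j₂ : H₂ ↪ H₁` carrying the universal such law `G` (for EVERY test scheme `T`).

## Proof of the second (the line's `stub_IIrep'_of`, over ★ names)
`H₁` is locally Noetherian (Mathlib `LocallyOfFiniteType.isLocallyNoetherian`).  (II-c₁) ★ `Morphisms.lawLocus_of_homScheme` (B-p20, [MFK94] proof of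
Prop. 6.16 first half: the law locus `Z ⊂ Hom_S(X ×_S X, X) × Hom_S(X, X)` cut out by the group identities, with its universal law `G_Z` and the
representability clauses (A)∕(B) on locally Noetherian test schemes), fed with the Hom-SCHEME of projective schemes (II-b) ★
`Morphisms.exists_homScheme_of_projective` (F0P1a-p03, [MFK94] Ch. 0 §5 (c); child line `F4IIbHomScheme`); (II-c₂) ★
`groupLawLocus_smooth_of_infinitesimalLifting` (B-typ03 (g19); «Prop. 6.15 is precisely the criterion for `ω` to be smooth», [EGA IV₄ 17.14.2]) fed
with Prop. 6.15 = the first theorem; (II-d) ★ `isOpenImmersion_lawLocus_of_smooth` (B-typ03 (g19); Cor. 6.6 ⇒ `ω` mono, smooth mono ⇒ open immersion,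
[EGA IV₄ 17.9.1]); (II-e) ★ `groupLawLocus_assembly` (B-p20; the relative-dimension-`g` open-closed part and the passage to all test schemes,
[MFK94] Prop. 7.3 step (II)).  No new mathematics in this file.

HONEST LABEL.  Print states Prop. 6.16 ∕ Thm. 6.14 for projective abelian schemes; the letter here IS the projective case (the line's older
`stub_IIrep`, proper `p₁`, is stronger than print and is NOT claimed).  The closedness of `H₂` (Koizumi) is not part of this statement ((γ)).

References:
* [MumfordFogartyKirwan1994] D. Mumford, J. Fogarty, F. Kirwan, *Geometric Invariant Theory*, 3rd ed., Springer 1994 — Ch. 6 §3 Prop. 6.15 (p. 124)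
  and its proof (pp. 124–125), Prop. 6.16 (p. 126) and its proof (p. 126), Thm. 6.14 (p. 124); Ch. 6 §1 Cor. 6.6 (p. 117); Ch. 7 §2 Prop. 7.3,
  step (II) (p. 132); Ch. 0 §5 (c) (p. 23).
* [EGAIV4] A. Grothendieck, J. Dieudonné, *Éléments de géométrie algébrique* IV₄, Publ. Math. IHÉS 32 (1967) — Prop. (17.14.2) (p. 98), Thm. (17.9.1) (p. 79).
-/

open CategoryTheory CategoryTheory.Limits AlgebraicGeometry MonoidalCategory
open Literature.AlgebraicGeometry.Morphisms (IsProjective)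

namespace Literature.AlgebraicGeometry.AbelianSchemes

open scoped MonObj

/-- **[MumfordFogartyKirwan1994] Ch. 6 §3 Proposition 6.15 (p. 124) — an infinitesimal deformation, with a section, of an abelian scheme is an
abelian scheme whose law EXTENDS the given one.**  `A` an Artin local ring, `J ⊆ A` a proper ideal with `𝔪·J = 0`, `X → Spec A` proper and
smooth with geometrically connected fibres and a section `ε`, `A₀` an abelian scheme over `Spec (A⧸J)` with a cartesian square `G : A₀.X → X`
over `Spec (A⧸J) → Spec A` whose unit is the restriction of `ε`: then there is a group law `GX` on `X` (an object `GrpObj X` of `Over (Spec A)`)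
with unit `ε`, making `X` an abelian scheme over `Spec A` of which `A₀` is the base change as a group scheme (★ `AbelianSchemeOver.IsBaseChangeVia`:
`G` intertwines units and multiplications — print: «`X₀ ≅ X ×_S S₀` as group schemes»).  Statement = the F-4 line's (II-a) letter `stub_IIa`
WITHOUT its (unused) `[Algebra ℚ A]` binder.  Proof = first half (II-a-E) ★ `exists_mul_lift_of_isPullback_specMap_mk` (the law lifts as a
morphism: the obstruction class in `H¹` dies on the slices, B-p01 (g16)) + second half (II-a-B) ★ `exists_grpObj_isBaseChangeVia_of_lift`
(any lift is an abelian-scheme law extending `μ₀`: shears are isomorphisms, unit ∕ associativity by rigidity, B-p04 (g22)).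
[cite: MumfordFogartyKirwan1994, Ch. 6 §3 Proposition 6.15 (p. 124) and its proof (pp. 124–125)] -/
theorem AbelianSchemeOver.exists_grpObj_extending_of_smallExtension :
    ∀ (A : Type) [CommRing A] [IsArtinianRing A] [IsLocalRing A] (J : Ideal A),
    J ≠ ⊤ → IsLocalRing.maximalIdeal A * J = ⊥ →
    ∀ (X : Over (Spec (.of A))) [IsProper X.hom] [Smooth X.hom] [GeometricallyConnected X.hom]
      (ε : Spec (.of A) ⟶ X.left) (_ : ε ≫ X.hom = 𝟙 _)
      (A₀ : AbelianSchemeOver (Spec (.of (A ⧸ J)))) (G : A₀.X.left ⟶ X.left)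
      (_ : IsPullback G A₀.X.hom X.hom (Spec.map (CommRingCat.ofHom (Ideal.Quotient.mk J))))
      (_ : (η[A₀.X]).left ≫ G = Spec.map (CommRingCat.ofHom (Ideal.Quotient.mk J)) ≫ ε),
    ∃ GX : GrpObj X, (@MonObj.one _ _ _ X GX.toMonObj).left = ε ∧
      A₀.IsBaseChangeVia (@AbelianSchemeOver.mk _ X GX ‹_› ‹_› ‹_›)
        (Spec.map (CommRingCat.ofHom (Ideal.Quotient.mk J))) G := by
  intro A _ _ _ J hJ hmJ X _ _ _ ε hε₁ A₀ G hG hε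
  -- first half (II-a-E): the law lifts as a morphism `m : X ×_S X → X`
  obtain ⟨m, hm⟩ := AbelianSchemeOver.exists_mul_lift_of_isPullback_specMap_mk A J hJ hmJ X A₀ G hG
  -- second half (II-a-B): any lift is an abelian-scheme law extending `μ₀`
  obtain ⟨GX, _, h1, h2⟩ := AbelianSchemeOver.exists_grpObj_isBaseChangeVia_of_lift hJ hG ε hε₁ hε m hm
  exact ⟨GX, h1, h2⟩

/-- **[MumfordFogartyKirwan1994] Ch. 6 §3 Proposition 6.16 (p. 126), with Proposition 6.15 (p. 124) inside — LINEAR RIGIDIFICATION, STEP (II):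
the representability half of Thm. 6.14 for a PROJECTIVE smooth `p₁ : Z₁ → H₁` with geometrically connected fibres over a `ℚ`-scheme locally
of finite type, with a section `ε₁`.**  The sub-functor of `H₁` «`Z₁ ×_{H₁} T → T` carries a group law with unit `ε₁|_T`, smooth of relative
dimension `g`» is represented by an OPEN immersion `j₂ : H₂ ↪ H₁` carrying the universal such law `G`: for every scheme `T` and `v : T → H₁`,
`v` factors (uniquely) through `j₂` iff `Z₁ ×_{H₁} T` carries such a law.  Statement = the (β)+(γ) letter hII″ (3c9b90749a899d48) under
`∀ (g : ℕ)` ≡ the F-4 line's `stub_IIrep'` (`Cruxes/HDel/Lines/F4LinearRigidificationII.lean` :449 of ED. 2.1) character for character; proof = that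
line's composition `stub_IIrep'_of` over the ★ layer-2 theorems (II-c₁) `Morphisms.lawLocus_of_homScheme` ∘ (II-b)
`Morphisms.exists_homScheme_of_projective`, (II-c₂) `groupLawLocus_smooth_of_infinitesimalLifting` ∘ Prop. 6.15
(`AbelianSchemeOver.exists_grpObj_extending_of_smallExtension`), (II-d) `isOpenImmersion_lawLocus_of_smooth`, (II-e) `groupLawLocus_assembly`.
[cite: MumfordFogartyKirwan1994, Ch. 6 §3 Proposition 6.16 (p. 126) and its proof (p. 126); Proposition 6.15 (p. 124); Ch. 6 §1 Corollary 6.6 (p. 117); Ch. 7 §2 Proposition 7.3, step (II) (p. 132); Ch. 0 §5 (c) (p. 23)]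
[cite: EGAIV4, Prop. (17.14.2), p. 98; Thm. (17.9.1), p. 79] -/
theorem AbelianSchemeOver.exists_groupLawLocus_of_projective :
    ∀ (g : ℕ) ⦃H₁ Z₁ : Scheme.{0}⦄ (p₁ : Z₁ ⟶ H₁) [IsProper p₁] [Smooth p₁] [GeometricallyConnected p₁]
    (_ : IsProjective p₁)
    (f₁ : H₁ ⟶ Spec (.of ℚ)) [LocallyOfFiniteType f₁] (ε₁ : H₁ ⟶ Z₁) (_ : ε₁ ≫ p₁ = 𝟙 H₁),
    ∃ (H₂ : Scheme.{0}) (j₂ : H₂ ⟶ H₁) (_ : IsOpenImmersion j₂)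
    (G : GrpObj (Over.mk (pullback.snd p₁ j₂))),
      (@MonObj.one _ _ _ (Over.mk (pullback.snd p₁ j₂)) G.toMonObj).left ≫ pullback.fst p₁ j₂ = j₂ ≫ ε₁ ∧
      SmoothOfRelativeDimension g (pullback.snd p₁ j₂) ∧
      ∀ ⦃T : Scheme.{0}⦄ (v : T ⟶ H₁),
        (∃! w : T ⟶ H₂, w ≫ j₂ = v) ↔
          ∃ G' : GrpObj (Over.mk (pullback.snd p₁ v)),
            (@MonObj.one _ _ _ (Over.mk (pullback.snd p₁ v)) G'.toMonObj).left ≫ pullback.fst p₁ v = v ≫ ε₁ ∧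
            SmoothOfRelativeDimension g (pullback.snd p₁ v) := by
  intro g H₁ Z₁ p₁ _ _ _ hproj f₁ _ ε₁ hε₁
  haveI : IsLocallyNoetherian H₁ := LocallyOfFiniteType.isLocallyNoetherian f₁
  -- (II-c₁) over (II-b): the law locus `ω : Z → H₁` with its universal law `G_Z` and the representability clauses (A)/(B)
  obtain ⟨Z, ω, _, hω, GZ, hunit, hrep⟩ :=
    Literature.AlgebraicGeometry.Morphisms.lawLocus_of_homScheme
      Literature.AlgebraicGeometry.Morphisms.exists_homScheme_of_projective p₁ hproj ε₁ hε₁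
  haveI : LocallyOfFiniteType ω := hω
  -- (II-c₂) over Prop. 6.15: `ω` is smooth (Artinian lifting)
  haveI : Smooth ω :=
    groupLawLocus_smooth_of_infinitesimalLifting
      (fun A _ _ _ _ J => AbelianSchemeOver.exists_grpObj_extending_of_smallExtension A J) p₁ f₁ ε₁ hε₁ ω GZ hunit hrep
  -- (II-d): smooth + mono (Cor. 6.6) ⇒ open immersion; the `∃!`-iff on locally Noetherian test schemes
  obtain ⟨hopen, hiff⟩ := isOpenImmersion_lawLocus_of_smooth p₁ ε₁ hε₁ ω GZ hunit hrep
  haveI : IsOpenImmersion ω := hopen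
  -- (II-e): relative-dimension-`g` split + all test schemes
  exact groupLawLocus_assembly g p₁ ε₁ hε₁ ω GZ hunit hiff

end Literature.AlgebraicGeometry.AbelianSchemes
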